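import Summits.QuantumFields.YangMills.Theorems.BalabanUVNodesN07DentRowsTwoBlocks
import Summits.QuantumFields.YangMills.Theorems.BalabanUVNodesN07NormalisationWideRows
import HarnessLib

/-!
# N07 [B11] (= [15] = [Balaban1985Variational]) Sect. F — THE CHART's DENT ROWS (print's (160), second case) RE-KEYED TO THE `Nrm` TEXT OF RECORD `NrmOfRecordWide` (MODULE 60′):
# MODULE 71's two record-level rows with the wide top gauge (window `□̃`, root `ctr`) — the top letter `α₁` now `(d−1)·crad·δ̂` from MODULE 62″'s rooted two-sided bound

Cell `pub-ymgap`, seat `pub-ymgap-dag-n07-e` g25 (FAN-OUT §N07 row s3; LANE OWNER of the K0 road), MODULE 71″ (plan g90 RULING A3 (4): «61″∕71″ re-keys»).  `--kind proof --supports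
stmt-QuantumFields-20541 --as helper` (K0⁷); count-neutral; def-free.  [15] = [Balaban1985Variational]; [6] = [Balaban1985RegularSpaces]; [3] = [Balaban1985Averaging]; [4] = [Balaban1984PropagatorsII].

WHY.  MODULE 71 (`…N07DentRowsTwoBlocks`, p676737) typed the dent rows under MODULE 60's `NrmOfRecord` (top axial gauge: pv26's corner-rooted `axialGauge` on the chart box); ruling A3 made
MODULE 60′ `NrmOfRecordWide` (window `□̃ = [tLo, tHi]`, root `ctr`) the text of record.  As announced in the queue («71 uses MODULE 40 only through the top letter α — swap the supplier»), THIS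
FILE is 71 §3 VERBATIM with three swaps: the identity `𝒜_m(U^u)(b) = M^m(U″)(b)` from MODULE 62″ `NrmOfRecordWide.exists_rep_bondIdx`; the representative's top gauge `h := axialGaugeAt … tLo
tHi ctr`; the parent's top letter `α₁ := (d−1)·crad·δ̂` from 62″ §1 `dist1_gaugeAct_axialGaugeAt_le_of_mem_boxBonds` + `abs_sub_ctr_le_crad` (in place of MODULE 40's `(d−1)·n·δ̂`), with the
`□̃`-box letter `hV` (= MODULE 69b″'s supply) and the non-wrapping `tHi − tLo < N_j`.  The representative-level content (71 §1∕§2: the sharp-hull radial within-block letter, MODULE 70's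
two-block Lemma 1) is CONSUMED BY NAME, unchanged.

WHAT IS PROVED (sorry-free; no definition; axioms standard; by-name composition).  ★★★ `NrmOfRecordWide.norm_mlog_shearedAvgIter_dent_crossing_le` (`≤ 2·((d−1)·crad·δ̂ + 7t₂ +
(d+1)(L−1)·τ_rad(a))`) · ★★ `NrmOfRecordWide.norm_mlog_shearedAvgIter_dent_within_le` (`≤ 2·τ_rad(a)`).

HONEST SCOPE.  Count-neutral; `NrmOfRecordWide` (its door CONDITIONAL on `HThm4Rec`, ruling A3), `Adm22`, `δ̂`, `a`, the box numerics and the guards are HYPOTHESES; which level-`(j−1)`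
LamBonds are dent pairs, the supplier of `a` (MODULE 72), ⚑ LOCATED-DENT-BOUNDARY, the COLLAR far rows and the (154)–(159) assembly are NOT here; HS3NORM ∕ HCHART-MEET-NORM ∕ HBUDGET-NORM
stay displayed in the knit (67c); K0⁷ ∕ K1⁹ NOT closed; N07 NOT discharged and NOT claimable on road (β); counts unmoved (typed 28∕28 · discharged 7∕28); one finite 𝕋⁴ programme at fixed
ε — the route closes the conditional finite-𝕋⁴ rung `BalabanLadder.UV` ONLY; the YM mass gap (Clay) is NOT proved by any of this; nothing continuum ∕ ℝ⁴ ∕ OS.  No `sorry`, no `def`, no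
`instance`, no `notation`.

References: [15] (147) p. 301, (154) p. 302, (160) p. 303 (second case); [6] (1.14)–(1.15) p. 78, Lemma 1 (1.24)–(1.25) p. 79, p. 98, (1.129) p. 98; [3] (21) p. 21, (88) p. 31;
[4] (2.1)–(2.3) p. 224.
-/

set_option autoImplicit false

noncomputable section
open scoped BigOperators Matrix.Norms.L2Operator

namespace Summit.QuantumFields.YangMills.BalabanUVNodes.N07DentRowsWide

open Literature.MathematicalPhysics.QuantumFieldTheory.Balaban1983to89
open Literature.MathematicalPhysics.QuantumFieldTheory.Balaban1983to89.Node00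
open T4Continuum (T4Family)
open T4AxialGaugeSmallField (castSite castSite_apply castSite_add_e boxBonds boxPlaqs)
open T4AxialGaugeRooted (axialGaugeAt)
open B7Prop1Explicit (e e_apply)
open B14DomainGeom (Pt)
open B8Eq131Cubes (tLo tHi ctr crad ctr_mem)
open GaugeField (gaugeAct plaqHol)
open ExpMeanLog (expMeanLogSU deltaSU)
open B12GaugeOrbits021 (IsResidual iter_gaugeAct_of_isResidual)
open B15Eq177GaugeInvariance (blockLift)
open MatrixLog (mlog norm_mlog_le_two_mul)
open Summit.QuantumFields.Balaban3D.Carriers (radialContourData)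
open Summit.QuantumFields.YangMills.Theorems.FlatCubeOpsText (Adm22)
open Summit.QuantumFields.YangMills.BalabanUVNodes.N07NormalisationOfRecordWide (NrmOfRecordWide)
open Summit.QuantumFields.YangMills.BalabanUVNodes.N07NormalisationWideRows (NrmOfRecordWide.exists_rep_bondIdx dist1_gaugeAct_axialGaugeAt_le_of_mem_boxBonds abs_sub_ctr_le_crad)
open Summit.QuantumFields.YangMills.BalabanUVNodes.N09AxialSelectionExists (iter_gaugeAct_blockLift)
open Summit.QuantumFields.YangMills.BalabanUVNodes.N07RadialAxialTower (radialTower_gaugeAct_blockLift)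
open Summit.QuantumFields.YangMills.BalabanUVNodes.N07DataDownTheTowerBlowDown (dist1_plaqHol_iter_gaugeAct)
open Summit.QuantumFields.YangMills.BalabanUVNodes.N07DentRowsTwoBlocks (dist1_iter_crossing_le_of_twoBlocks dist1_iter_within_le_of_box)

/-! ## §1  At the record under `NrmOfRecordWide`: the dent rows of the chart's datum -/

section Record

variable (F : T4Family) (N : ℕ) [NeZero N]

/-- ★★★ **THE DENT CROSSING ROWS OF THE CHART's DATUM UNDER `NrmOfRecordWide` — print's (160), second case, at the objects of record**: under the normalisation of record at `(j, idx)`,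
`j = m + 1`, the (2.2) collar of `D″`, the displayed `□̃`-box letter `δ̂` («(7) for V» on `[tLo, tHi]`, non-wrapping) and the displayed TWO-BLOCK letter `a` (the level-`m` plaquettes of `M^m U`
based in `B(castSite t) ∪ B(castSite (t + e_μ))`, print's `α₀ = L²ε₁`): for every `D″`-constraint bond `b` of level `m` crossing from `B(castSite t)` into `B(castSite (t + e_μ))` whose parent
`⟨castSite t, μ⟩` is a box bond of `□̃`, `‖log 𝒜_m(U^u)(b)‖ ≤ 2·((d−1)·crad·δ̂ + 7t₂ + (d+1)(L−1)·τ_rad(a))` — δ-LINEAR in `(δ̂, a)`, `crad = ⌊sideP∕2⌋ + 2ρ`.  `𝒜_m(U^u)(b) = M^m(U″)(b)`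
(MODULE 62″ §2), `U″ = (U^w)^{h̄}` keeps the radial tower (dag-n07-w6) and has top `(M^j U)^h`, `h = axialGaugeAt … ctr` (`α₁ = (d−1)·crad·δ̂`, MODULE 62″ §1); MODULE 71 §2.  Guards: `0 < a`,
`2L < N_m`, MODULE 68's `δ_N`-guard; log range `… ≤ ½`.
[cite: Balaban1985Variational, (160) p.303, (147) p.301, (154) p.302; Balaban1985RegularSpaces, Lemma 1 (1.25) p.79, (1.15) p.78; Balaban1985Averaging, (21) p.21, (88) p.31; Balaban1984PropagatorsII, (2.1)–(2.3) p.224] -/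
theorem NrmOfRecordWide.norm_mlog_shearedAvgIter_dent_crossing_le {Mc ρ : ℕ} {ν : Stage7Numerics} {M : ℕ} {g : ℕ → ℝ} {K k : ℕ} {s : SeqOfRecord F ν M g K k}
    {U : GaugeField (F.P K) 0 (SU N)} {m : ℕ} {idx : Pt (F.P K).d} {u : GaugeTransf (F.P K) 0 (SU N)} {A : PBond (F.P K) 0 → MatA N}
    (hN : NrmOfRecordWide F N Mc ρ ν M g K k s U (m + 1) idx u A) (hk : m + 1 ≤ (F.P K).m + (F.P K).K) {R Mb : ℕ}
    (hAdm : Adm22 (domainsMeet (cubeDomains (F.P K) (cornerP (F.P K) Mc ρ idx) (sideP (F.P K) Mc ρ) ρ (m + 1) hk) (domainsOfSeq s.Ω (m + 1) hk)) R Mb)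
    (hRM : 2 * (F.P K).L ≤ R * Mb + 1)
    -- the `□̃`-box letter `δ̂` (as MODULE 62″), the box numerics and `1 ≤ ρ` (so `1 ≤ sideP`, the centre lies in `□̃`)
    (hρ : 1 ≤ ρ) {δ' : ℝ} (hδ : 0 ≤ δ')
    (hV : PlaqSmallOn (boxPlaqs (tLo (cornerP (F.P K) Mc ρ idx) ρ) (tHi (cornerP (F.P K) Mc ρ idx) (sideP (F.P K) Mc ρ) ρ)) δ'
      (Averaging.iter (avOfRecord F N K) (m + 1) U))
    (hnN : ∀ κ, (tHi (cornerP (F.P K) Mc ρ idx) (sideP (F.P K) Mc ρ) ρ) κ - (tLo (cornerP (F.P K) Mc ρ idx) ρ) κ < (F.P K).sitesPerDir (m + 1))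
    -- the dent pair and its two-block letter `a`
    (t : Pt (F.P K).d) (μ : Fin (F.P K).d)
    (hpar : (⟨castSite t, μ⟩ : PBond (F.P K) (m + 1)) ∈ boxBonds (tLo (cornerP (F.P K) Mc ρ idx) ρ) (tHi (cornerP (F.P K) Mc ρ idx) (sideP (F.P K) Mc ρ) ρ))
    {a : ℝ} (ha : 0 < a) (hNm : 2 * (F.P K).L < (F.P K).sitesPerDir m)
    (ht : (((((F.P K).d + 2) * (F.P K).L : ℕ) : ℝ) ^ 2 / 4) * ((4 * (((((F.P K).d - 1 : ℕ) : ℝ)) * ((2 * (F.P K).L - 1 : ℕ) : ℝ)) + 1) * a) < deltaSU (Fin N))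
    (hA : PlaqSmallOn (boxPlaqs (fun i => ((F.P K).L : ℤ) * t i) (fun i => ((F.P K).L : ℤ) * (t + e μ) i + (((F.P K).L : ℤ) - 1))) a
      (Averaging.iter (avOfRecord F N K) m U))
    (hr : (((F.P K).d - 1 : ℕ) : ℝ) * (crad (sideP (F.P K) Mc ρ) ρ : ℕ) * δ' +
        7 * ((((((F.P K).d + 2) * (F.P K).L : ℕ) : ℝ) ^ 2 / 4) * ((4 * (((((F.P K).d - 1 : ℕ) : ℝ)) * ((2 * (F.P K).L - 1 : ℕ) : ℝ)) + 1) * a)) +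
        ((((F.P K).d + 1) * ((F.P K).L - 1) : ℕ) : ℝ) *
          ((((F.P K).d * ((F.P K).L - 1) + 1 : ℕ) : ℝ) * (((((F.P K).d - 1 : ℕ) : ℝ) * (((F.P K).L - 1 : ℕ) : ℝ)) * a)) ≤ 1 / 2)
    -- the bond: a `D″`-constraint bond of level `m` crossing from `B(castSite t)` to `B(castSite (t + e_μ))`
    (b : PBond (F.P K) m)
    (hb : (domainsMeet (cubeDomains (F.P K) (cornerP (F.P K) Mc ρ idx) (sideP (F.P K) Mc ρ) ρ (m + 1) hk) (domainsOfSeq s.Ω (m + 1) hk)).LamBond m b)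
    (hsrc : blockOf b.src = (castSite t : Site (F.P K) (m + 1))) (hdir : b.dir = μ) (htgt : blockOf b.tgt = (castSite (t + e μ) : Site (F.P K) (m + 1))) :
    ‖mlog ((shearedAvgIter (avOfRecord F N K) (fun i => radialContourData (F.P K) i (SU N)) (loopAvgBlockOp expMeanLogSU) (gaugeAct u U) m b : SU N) : MatA N)‖ ≤
      2 * ((((F.P K).d - 1 : ℕ) : ℝ) * (crad (sideP (F.P K) Mc ρ) ρ : ℕ) * δ' +
        7 * ((((((F.P K).d + 2) * (F.P K).L : ℕ) : ℝ) ^ 2 / 4) * ((4 * (((((F.P K).d - 1 : ℕ) : ℝ)) * ((2 * (F.P K).L - 1 : ℕ) : ℝ)) + 1) * a)) +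
        ((((F.P K).d + 1) * ((F.P K).L - 1) : ℕ) : ℝ) *
          ((((F.P K).d * ((F.P K).L - 1) + 1 : ℕ) : ℝ) * (((((F.P K).d - 1 : ℕ) : ℝ) * (((F.P K).L - 1 : ℕ) : ℝ)) * a))) := by
  set D'' := domainsMeet (cubeDomains (F.P K) (cornerP (F.P K) Mc ρ idx) (sideP (F.P K) Mc ρ) ρ (m + 1) hk) (domainsOfSeq s.Ω (m + 1) hk) with hD''
  obtain ⟨w, hres, hax, hall⟩ := NrmOfRecordWide.exists_rep_bondIdx hN hk hAdm hRM
  have hlt : m < D''.k + 1 := by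
    show m < min (m + 1) (m + 1) + 1
    rw [min_self]; omega
  have hid := hall ⟨⟨⟨m, hlt⟩, b⟩, hb⟩
  -- the representative `U″ = (U^w)^{h̄}` and its letters
  have hresid : Averaging.iter (avOfRecord F N K) (m + 1) (gaugeAct w U) = Averaging.iter (avOfRecord F N K) (m + 1) U :=
    iter_gaugeAct_of_isResidual (avOfRecord F N K) hk hres U
  set h : GaugeTransf (F.P K) (m + 1) (SU N) := axialGaugeAt (Averaging.iter (avOfRecord F N K) (m + 1) U)
    (tLo (cornerP (F.P K) Mc ρ idx) ρ) (tHi (cornerP (F.P K) Mc ρ idx) (sideP (F.P K) Mc ρ) ρ) (ctr (cornerP (F.P K) Mc ρ idx) (sideP (F.P K) Mc ρ)) with hh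
  set U'' : GaugeField (F.P K) 0 (SU N) := gaugeAct (blockLift (m + 1) h) (gaugeAct w U) with hU''
  rw [hresid] at hid
  -- (i) `U″` keeps the radial tower; in particular its level-`m` average is radially axial
  have htower : AxialGauge (radialContourData (F.P K) m (SU N)) (Averaging.iter (avOfRecord F N K) m U'') :=
    radialTower_gaugeAct_blockLift F N K hk h (gaugeAct w U) hax m (Nat.lt_succ_self m)
  -- (ii) the plaquettes of `M^m U″` are those of `M^m U` (gauge invariance, twice)
  have hW : PlaqSmallOn (boxPlaqs (fun i => ((F.P K).L : ℤ) * t i) (fun i => ((F.P K).L : ℤ) * (t + e μ) i + (((F.P K).L : ℤ) - 1))) a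
      (Averaging.iter (avOfRecord F N K) m U'') := by
    intro q hq
    have h1 := dist1_plaqHol_iter_gaugeAct (F := F) (N := N) (K := K) (by omega : m ≤ (F.P K).m + (F.P K).K) (blockLift (m + 1) h) (gaugeAct w U) q
    have h2 := dist1_plaqHol_iter_gaugeAct (F := F) (N := N) (K := K) (by omega : m ≤ (F.P K).m + (F.P K).K) w U q
    rw [hU'', h1, h2]
    exact hA q hq
  -- (iii) the top of `U″` is `(M^j U)^h`: the parent's letter `α₁ = (d−1)nδ̂` (MODULE 40)
  have htop : Averaging.iter (avOfRecord F N K) (m + 1) U'' = gaugeAct h (Averaging.iter (avOfRecord F N K) (m + 1) U) := by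
    rw [hU'', iter_gaugeAct_blockLift (avOfRecord F N K) hk h (gaugeAct w U), hresid]
  have hα : dist1 (Averaging.iter (avOfRecord F N K) (m + 1) U'' ⟨castSite t, μ⟩) ≤ (((F.P K).d - 1 : ℕ) : ℝ) * (crad (sideP (F.P K) Mc ρ) ρ : ℕ) * δ' := by
    rw [htop, hh]
    have hS1 : 1 ≤ sideP (F.P K) Mc ρ := by
      have := le_sideP (P := F.P K) Mc (lt_of_lt_of_le Nat.zero_lt_one hρ); omega
    obtain ⟨hr1, hr2, -⟩ := ctr_mem (a := cornerP (F.P K) Mc ρ idx) (ρ := ρ) hS1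
    exact dist1_gaugeAct_axialGaugeAt_le_of_mem_boxBonds _ subset_rfl hV hδ hnN hr1 hr2 (fun x hx hx' κ => abs_sub_ctr_le_crad hS1 x hx hx' κ) hpar
  -- (iv) §2 at `U″`, then MODULE 61's identity and the logarithm's Lipschitz bound
  have hrow := dist1_iter_crossing_le_of_twoBlocks hk U'' htower ha hNm ht t μ hW hα b hsrc hdir htgt
  rw [hid]
  exact (norm_mlog_le_two_mul (hrow.trans hr)).trans (mul_le_mul_of_nonneg_left hrow (by norm_num))

/-- ★★ **THE DENT WITHIN-BLOCK ROWS UNDER `NrmOfRecordWide`**: the same for a `D″`-constraint bond of level `m` with BOTH ends in `B(castSite t)`: `‖log 𝒜_m(U^u)(b)‖ ≤ 2·τ_rad(a)` from the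
block's own plaquette letter (the radial tower of `U″`; no top letter needed) — MODULE 71's within row with the identity re-keyed to the wide window. [cite: Balaban1985Variational, (160) p.303; Balaban1985RegularSpaces, (1.15) p.78, pp.79–80] -/
theorem NrmOfRecordWide.norm_mlog_shearedAvgIter_dent_within_le {Mc ρ : ℕ} {ν : Stage7Numerics} {M : ℕ} {g : ℕ → ℝ} {K k : ℕ} {s : SeqOfRecord F ν M g K k}
    {U : GaugeField (F.P K) 0 (SU N)} {m : ℕ} {idx : Pt (F.P K).d} {u : GaugeTransf (F.P K) 0 (SU N)} {A : PBond (F.P K) 0 → MatA N}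
    (hN : NrmOfRecordWide F N Mc ρ ν M g K k s U (m + 1) idx u A) (hk : m + 1 ≤ (F.P K).m + (F.P K).K) {R Mb : ℕ}
    (hAdm : Adm22 (domainsMeet (cubeDomains (F.P K) (cornerP (F.P K) Mc ρ idx) (sideP (F.P K) Mc ρ) ρ (m + 1) hk) (domainsOfSeq s.Ω (m + 1) hk)) R Mb)
    (hRM : 2 * (F.P K).L ≤ R * Mb + 1)
    (t : Pt (F.P K).d) {a : ℝ} (ha : 0 ≤ a) (hNm : (F.P K).L < (F.P K).sitesPerDir m)
    (hA : PlaqSmallOn (boxPlaqs (fun i => ((F.P K).L : ℤ) * t i) (fun i => ((F.P K).L : ℤ) * t i + (((F.P K).L : ℤ) - 1))) a (Averaging.iter (avOfRecord F N K) m U))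
    (hr : (((F.P K).d * ((F.P K).L - 1) + 1 : ℕ) : ℝ) * (((((F.P K).d - 1 : ℕ) : ℝ) * (((F.P K).L - 1 : ℕ) : ℝ)) * a) ≤ 1 / 2)
    (b : PBond (F.P K) m)
    (hb : (domainsMeet (cubeDomains (F.P K) (cornerP (F.P K) Mc ρ idx) (sideP (F.P K) Mc ρ) ρ (m + 1) hk) (domainsOfSeq s.Ω (m + 1) hk)).LamBond m b)
    (hsrc : blockOf b.src = (castSite t : Site (F.P K) (m + 1))) (htgt : blockOf b.tgt = (castSite t : Site (F.P K) (m + 1))) :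
    ‖mlog ((shearedAvgIter (avOfRecord F N K) (fun i => radialContourData (F.P K) i (SU N)) (loopAvgBlockOp expMeanLogSU) (gaugeAct u U) m b : SU N) : MatA N)‖ ≤
      2 * ((((F.P K).d * ((F.P K).L - 1) + 1 : ℕ) : ℝ) * (((((F.P K).d - 1 : ℕ) : ℝ) * (((F.P K).L - 1 : ℕ) : ℝ)) * a)) := by
  set D'' := domainsMeet (cubeDomains (F.P K) (cornerP (F.P K) Mc ρ idx) (sideP (F.P K) Mc ρ) ρ (m + 1) hk) (domainsOfSeq s.Ω (m + 1) hk) with hD''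
  obtain ⟨w, hres, hax, hall⟩ := NrmOfRecordWide.exists_rep_bondIdx hN hk hAdm hRM
  have hlt : m < D''.k + 1 := by
    show m < min (m + 1) (m + 1) + 1
    rw [min_self]; omega
  have hid := hall ⟨⟨⟨m, hlt⟩, b⟩, hb⟩
  have hresid : Averaging.iter (avOfRecord F N K) (m + 1) (gaugeAct w U) = Averaging.iter (avOfRecord F N K) (m + 1) U :=
    iter_gaugeAct_of_isResidual (avOfRecord F N K) hk hres U
  set h : GaugeTransf (F.P K) (m + 1) (SU N) := axialGaugeAt (Averaging.iter (avOfRecord F N K) (m + 1) U)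
    (tLo (cornerP (F.P K) Mc ρ idx) ρ) (tHi (cornerP (F.P K) Mc ρ idx) (sideP (F.P K) Mc ρ) ρ) (ctr (cornerP (F.P K) Mc ρ idx) (sideP (F.P K) Mc ρ)) with hh
  set U'' : GaugeField (F.P K) 0 (SU N) := gaugeAct (blockLift (m + 1) h) (gaugeAct w U) with hU''
  rw [hresid] at hid
  have htower : AxialGauge (radialContourData (F.P K) m (SU N)) (Averaging.iter (avOfRecord F N K) m U'') :=
    radialTower_gaugeAct_blockLift F N K hk h (gaugeAct w U) hax m (Nat.lt_succ_self m)
  have hW : PlaqSmallOn (boxPlaqs (fun i => ((F.P K).L : ℤ) * t i) (fun i => ((F.P K).L : ℤ) * t i + (((F.P K).L : ℤ) - 1))) a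
      (Averaging.iter (avOfRecord F N K) m U'') := by
    intro q hq
    have h1 := dist1_plaqHol_iter_gaugeAct (F := F) (N := N) (K := K) (by omega : m ≤ (F.P K).m + (F.P K).K) (blockLift (m + 1) h) (gaugeAct w U) q
    have h2 := dist1_plaqHol_iter_gaugeAct (F := F) (N := N) (K := K) (by omega : m ≤ (F.P K).m + (F.P K).K) w U q
    rw [hU'', h1, h2]
    exact hA q hq
  have hrow := dist1_iter_within_le_of_box hk U'' htower ha hNm t hW b hsrc htgt
  rw [hid]
  exact (norm_mlog_le_two_mul (hrow.trans hr)).trans (mul_le_mul_of_nonneg_left hrow (by norm_num))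

end Record

end Summit.QuantumFields.YangMills.BalabanUVNodes.N07DentRowsWide

end
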